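import Summits.SmoothPoincare4.SmoothPoincare4.Theses.SullivanDual
import Summits.SmoothPoincare4.SmoothPoincare4.Theorems.SullivanDualAdmissibleJExists
import Literature.Geometry.Symplectic.GromovR4StdModel
import Literature.Geometry.Symplectic.SteinBall

/-!
# SmoothPoincare4 / SullivanDual — crux `Target` (stmt-SmoothPoincare4-7823), stub `stub_omegaFlat`

The flat collar form on `ℝ⁴ = ℂ²` (line `Sketch`, Stub A): for radii `0 < R₄ < R₃ < R` a `C^∞`
closed `2`-form `Ω` on `ℝ⁴` which vanishes on the closed `R₄`-ball, equals the standard symplectic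
form `ω₀` outside the `R`-ball, is `J₀`-non-negative everywhere and uniformly `J₀`-positive outside
the `R₃`-ball.

Construction.  With the ambient `1`-form `α₀(w)(v) = 2⟪w, J₀ v⟫` of `SteinBall.lean` (so that the
Liouville form is `λ₀ = -¼ α₀`, `dα₀(a, b) = 4⟪a, J₀ b⟫ = -4 ω₀(a, b)`), put
`Ω = -¼ d(f α₀)` where `f(w) = g(‖w‖²)` and `g` is a smooth non-decreasing transition equal to
`0` on `(-∞, R₄'²]` and to `1` on `[R₃², ∞)`, `R₄ < R₄' < R₃`.  Then `d ∘ d = 0` gives closedness,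
`f = 0` near the closed `R₄`-ball and `f = 1` near `{R ≤ ‖w‖}` give the two normalisations, and the
Leibniz rule gives `Ω_w(a, J₀ a) = g'(‖w‖²) (⟪w, a⟫² + ⟪w, J₀ a⟫²) + f(w) ‖a‖² ≥ f(w) ‖a‖²`.

References: D. McDuff, D. Salamon, *Introduction to Symplectic Topology*, 3rd ed. (2017), §1.1
(Liouville form `λ₀`, `dλ₀ = ω₀`); folklore.
-/

noncomputable section

-- the registered namespace `Summit.SmoothPoincare4.SmoothPoincare4.Theorems` repeats a component
set_option linter.dupNamespace false

open scoped Manifold ContDiff Topology RealInnerProductSpace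
open Set Filter Metric
open Literature.Geometry.Kaehler Literature.Geometry.Symplectic

namespace Summit.SmoothPoincare4.SmoothPoincare4.Theorems

namespace SullivanDual

/-- `α₀` as a continuous linear map of the base point evaluates like `α₀`:
`α₀(w)(v) = 2⟪w, J₀ v₀⟫`. [folklore] -/
theorem stub_omegaFlat_ambAlphaCLM_apply (w : EuclideanSpace ℝ (Fin 4))
    (v : Fin 1 → EuclideanSpace ℝ (Fin 4)) :
    ambAlphaCLM w v = 2 * ⟪w, stdComplexStructure (v 0)⟫ :=
  ambAlpha_apply w v

/-- **Leibniz rule for `d(F α₀)`** in Mathlib's normalisation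
`dθ(a, b) = Dθ(a)·b - Dθ(b)·a`: for a real function `F` with derivative `F'` at `w`,
`d(F α₀)_w(a, b) = 2 (F'a ⟪w, J₀ b⟫ - F'b ⟪w, J₀ a⟫) + 4 F(w) ⟪a, J₀ b⟫`. [folklore] -/
theorem stub_omegaFlat_extDeriv_smul_ambAlpha_apply {F : EuclideanSpace ℝ (Fin 4) → ℝ}
    {F' : EuclideanSpace ℝ (Fin 4) →L[ℝ] ℝ} {w : EuclideanSpace ℝ (Fin 4)}
    (hF : HasFDerivAt F F' w) (a b : EuclideanSpace ℝ (Fin 4)) :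
    extDeriv (fun y => F y • ambAlpha y) w ![a, b] =
      2 * (F' a * ⟪w, stdComplexStructure b⟫ - F' b * ⟪w, stdComplexStructure a⟫) +
        4 * F w * ⟪a, stdComplexStructure b⟫ := by
  have h : HasFDerivAt (fun y => F y • ambAlpha y)
      (F w • ambAlphaCLM + F'.smulRight (ambAlpha w)) w :=
    hF.smul (hasFDerivAt_ambAlpha w)
  rw [extDeriv, h.fderiv, ContinuousAlternatingMap.alternatizeUncurryFin_apply]
  simp only [Nat.reduceAdd, Int.reduceNeg, add_apply, smul_apply,
    ContinuousLinearMap.smulRight_apply, ContinuousAlternatingMap.add_apply,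
    ContinuousAlternatingMap.coe_smul, Pi.smul_apply, stub_omegaFlat_ambAlphaCLM_apply,
    Fin.removeNth, Fin.isValue, smul_eq_mul, ambAlpha_apply, smul_add, zsmul_eq_mul, Int.cast_pow,
    Int.cast_neg, Int.cast_one, Fin.sum_univ_succ, Fin.coe_ofNat_eq_mod, Nat.zero_mod, pow_zero,
    Matrix.cons_val_zero, Fin.zero_succAbove, Fin.succ_zero_eq_one, Matrix.cons_val_one,
    Matrix.cons_val_fin_one, one_mul, Finset.univ_unique, Fin.default_eq_zero, Fin.val_succ,
    Fin.val_eq_zero, zero_add, pow_one, Matrix.cons_val_succ, ne_eq, Fin.succ_ne_zero,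
    not_false_eq_true, Fin.succAbove_ne_zero_zero, neg_mul, Finset.sum_const,
    Finset.card_singleton, smul_neg, one_smul]
  rw [inner_stdComplexStructure_right b a, real_inner_comm (stdComplexStructure b) a]
  ring

/-- A smooth non-decreasing transition `g : ℝ → [0, 1]` with `g = 0` on `(-∞, s₀]` and `g = 1`
on `[s₁, ∞)`, for `s₀ < s₁` (a rescaled `Real.smoothTransition`). [folklore] -/
theorem stub_omegaFlat_exists_transition (s₀ s₁ : ℝ) (hs : s₀ < s₁) :
    ∃ g : ℝ → ℝ, ContDiff ℝ ∞ g ∧ Monotone g ∧ (∀ t, t ≤ s₀ → g t = 0) ∧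
      (∀ t, s₁ ≤ t → g t = 1) ∧ ∀ t, 0 ≤ g t := by
  have hd : 0 < s₁ - s₀ := sub_pos.2 hs
  refine ⟨fun t => Real.smoothTransition ((t - s₀) / (s₁ - s₀)), ?_, ?_, ?_, ?_, ?_⟩
  · exact Real.smoothTransition.contDiff.comp ((contDiff_id.sub contDiff_const).div_const _)
  · exact Real.smoothTransition.monotone.comp fun t₁ t₂ ht =>
      div_le_div_of_nonneg_right (sub_le_sub_right ht _) hd.le
  · exact fun t ht => Real.smoothTransition.zero_of_nonpos
      (div_nonpos_of_nonpos_of_nonneg (sub_nonpos.2 ht) hd.le)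
  · exact fun t ht => Real.smoothTransition.one_of_one_le
      ((one_le_div hd).2 (sub_le_sub_right ht _))
  · exact fun t => Real.smoothTransition.nonneg _

/-- **Stub A (flat collar form).** For radii `0 < R₄ < R₃ < R` there is a `C^∞` closed `2`-form
`Ω` on `ℝ⁴` (as a map `ℝ⁴ → ℝ⁴ [⋀^Fin 2]→L[ℝ] ℝ`, closed for Mathlib's `extDeriv`) which vanishes
on the closed ball of radius `R₄`, equals the standard symplectic form `ω₀` outside the ball of
radius `R`, is `J₀`-non-negative everywhere (`Ω_w(a, J₀ a) ≥ 0`, `J₀ = stdComplexStructure`) and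
uniformly `J₀`-positive outside the ball of radius `R₃` (`Ω_w(a, J₀ a) ≥ c ‖a‖²`).
Construction: `Ω = d(f λ₀)` with `λ₀(w) = ½ ω₀(w, ·) = -¼ α₀(w)` and `f = g(‖w‖²)`, `g` a smooth
non-decreasing transition; `d(fλ₀)(a, J₀a) = g'·(⟪w,a⟫² + ⟪w,J₀a⟫²) + f ‖a‖²`. [folklore] -/
theorem stub_omegaFlat (R₄ R₃ R : ℝ) (h₄ : 0 < R₄) (h₄₃ : R₄ < R₃) (h₃ : R₃ < R) :
    ∃ Ω : EuclideanSpace ℝ (Fin 4) → (EuclideanSpace ℝ (Fin 4)) [⋀^Fin 2]→L[ℝ] ℝ,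
      ContDiff ℝ ∞ Ω ∧ (∀ w, extDeriv Ω w = 0) ∧
      (∀ w, ‖w‖ ≤ R₄ → Ω w = 0) ∧
      (∀ w, R ≤ ‖w‖ → ∀ a b, Ω w ![a, b] = stdSymplecticForm a b) ∧
      (∀ w a, 0 ≤ Ω w ![a, stdComplexStructure a]) ∧
      (∃ c : ℝ, 0 < c ∧ ∀ w, R₃ ≤ ‖w‖ → ∀ a, c * ‖a‖ ^ 2 ≤ Ω w ![a, stdComplexStructure a]) := by
  -- levels `s₀ = R₄'² < s₁ = R₃²` with `R₄ < R₄' = (R₄ + R₃)/2 < R₃`, and the transition `g`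
  have hR₄' : R₄ < (R₄ + R₃) / 2 := by linarith
  have hR₄'₃ : (R₄ + R₃) / 2 < R₃ := by linarith
  have hs : ((R₄ + R₃) / 2) ^ 2 < R₃ ^ 2 := by nlinarith
  obtain ⟨g, hgc, hgm, hg0, hg1, hgnn⟩ :=
    stub_omegaFlat_exists_transition (((R₄ + R₃) / 2) ^ 2) (R₃ ^ 2) hs
  -- the cut-off `f = g (‖·‖²)` and its derivative
  have hfc : ContDiff ℝ ∞ fun y : EuclideanSpace ℝ (Fin 4) => g (‖y‖ ^ 2) :=
    hgc.comp (contDiff_norm_sq ℝ)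
  have hfd : ∀ w : EuclideanSpace ℝ (Fin 4), HasFDerivAt (fun y : EuclideanSpace ℝ (Fin 4) =>
      g (‖y‖ ^ 2)) (deriv g (‖w‖ ^ 2) • (2 • innerSL ℝ w)) w := fun w =>
    ((hgc.differentiable (by simp)) _).hasDerivAt.comp_hasFDerivAt w (hasFDerivAt_norm_sq_four w)
  -- the `1`-form `θ = f α₀`; `Ω = -¼ dθ`
  have hθc : ContDiff ℝ ∞ fun y : EuclideanSpace ℝ (Fin 4) => g (‖y‖ ^ 2) • ambAlpha y :=
    hfc.smul contDiff_ambAlpha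
  have hdθc : ContDiff ℝ ∞
      (extDeriv fun y : EuclideanSpace ℝ (Fin 4) => g (‖y‖ ^ 2) • ambAlpha y) := by
    unfold extDeriv
    exact (ContinuousAlternatingMap.alternatizeUncurryFinCLM ℝ (EuclideanSpace ℝ (Fin 4))
      ℝ).contDiff.comp (hθc.fderiv_right (m := ∞) (by simp))
  -- the key pointwise formula `Ω_w(a, J₀ a) = g'(‖w‖²)(⟪w,a⟫² + ⟪w,J₀a⟫²) + f(w)‖a‖²`
  have hkey : ∀ w a : EuclideanSpace ℝ (Fin 4),
      ((-4⁻¹ : ℝ) • extDeriv (fun y : EuclideanSpace ℝ (Fin 4) => g (‖y‖ ^ 2) • ambAlpha y) w)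
        ![a, stdComplexStructure a] =
      deriv g (‖w‖ ^ 2) * (⟪w, a⟫ ^ 2 + ⟪w, stdComplexStructure a⟫ ^ 2) +
        g (‖w‖ ^ 2) * ‖a‖ ^ 2 := by
    intro w a
    rw [ContinuousAlternatingMap.smul_apply,
      stub_omegaFlat_extDeriv_smul_ambAlpha_apply (hfd w) a (stdComplexStructure a)]
    simp only [smul_apply, smul_eq_mul, nsmul_eq_mul, Nat.cast_ofNat, innerSL_apply_apply,
      stdComplexStructure_sq, inner_neg_right, real_inner_self_eq_norm_sq]
    ring
  refine ⟨fun w => (-4⁻¹ : ℝ) • extDeriv (fun y => g (‖y‖ ^ 2) • ambAlpha y) w,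
    hdθc.const_smul (-4⁻¹ : ℝ), fun w => ?_, fun w hw => ?_, fun w hw a b => ?_,
    fun w a => ?_, ⟨1, one_pos, fun w hw a => ?_⟩⟩
  · -- closedness: `d(-¼ dθ) = -¼ ddθ = 0`
    rw [show (fun w => (-4⁻¹ : ℝ) •
        extDeriv (fun y : EuclideanSpace ℝ (Fin 4) => g (‖y‖ ^ 2) • ambAlpha y) w) =
        (-4⁻¹ : ℝ) • extDeriv (fun y : EuclideanSpace ℝ (Fin 4) => g (‖y‖ ^ 2) • ambAlpha y)
        from rfl, extDeriv_smul, extDeriv_extDeriv hθc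
        (by rw [minSmoothness_of_isRCLikeNormedField]; exact WithTop.coe_le_coe.mpr le_top),
      Pi.zero_apply, smul_zero]
  · -- vanishing on the closed `R₄`-ball: `θ = 0` on the open `R₄'`-ball
    have hev : (fun y : EuclideanSpace ℝ (Fin 4) => g (‖y‖ ^ 2) • ambAlpha y) =ᶠ[𝓝 w]
        fun _ => 0 := by
      have hU : IsOpen {y : EuclideanSpace ℝ (Fin 4) | ‖y‖ < (R₄ + R₃) / 2} :=
        isOpen_lt continuous_norm continuous_const
      filter_upwards [hU.mem_nhds (show ‖w‖ < (R₄ + R₃) / 2 by simpa using hw.trans_lt hR₄')]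
        with y hy
      have hy' : ‖y‖ ^ 2 ≤ ((R₄ + R₃) / 2) ^ 2 :=
        pow_le_pow_left₀ (norm_nonneg _) (le_of_lt hy) 2
      simp [hg0 _ hy']
    simp only
    rw [hev.extDeriv_eq, extDeriv, fderiv_const_apply,
      ← ContinuousAlternatingMap.alternatizeUncurryFinCLM_apply, map_zero, smul_zero]
  · -- equality with `ω₀` for `R ≤ ‖w‖`: `θ = α₀` on the open set `{R₃ < ‖y‖}`
    have hev : (fun y : EuclideanSpace ℝ (Fin 4) => g (‖y‖ ^ 2) • ambAlpha y) =ᶠ[𝓝 w]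
        ambAlpha := by
      have hU : IsOpen {y : EuclideanSpace ℝ (Fin 4) | R₃ < ‖y‖} :=
        isOpen_lt continuous_const continuous_norm
      filter_upwards [hU.mem_nhds (show R₃ < ‖w‖ from h₃.trans_le hw)] with y hy
      have hy' : R₃ ^ 2 ≤ ‖y‖ ^ 2 :=
        pow_le_pow_left₀ (h₄.trans h₄₃).le (le_of_lt hy) 2
      simp [hg1 _ hy']
    simp only
    rw [hev.extDeriv_eq, ContinuousAlternatingMap.smul_apply, extDeriv_ambAlpha_apply,
      inner_stdComplexStructure_right, inner_stdComplexStructure_eq_stdSymplecticForm]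
    ring
  · -- `J₀`-non-negativity
    simp only
    rw [hkey]
    exact add_nonneg (mul_nonneg hgm.deriv_nonneg (by positivity))
      (mul_nonneg (hgnn _) (by positivity))
  · -- uniform `J₀`-positivity for `R₃ ≤ ‖w‖` (there `f = 1`)
    simp only
    have hw' : R₃ ^ 2 ≤ ‖w‖ ^ 2 := pow_le_pow_left₀ (h₄.trans h₄₃).le hw 2
    rw [hkey, hg1 _ hw', one_mul]
    exact le_add_of_nonneg_left (mul_nonneg hgm.deriv_nonneg (by positivity))

end SullivanDual

end Summit.SmoothPoincare4.SmoothPoincare4.Theorems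

end
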